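import Summits.ResolutionOfSingularities.ResolutionOfSingularities.Theorems.RadicialJungCleanModelsSufficeOneCharged
import Literature.AlgebraicGeometry.Resolution.RsopLocalization
import Literature.AlgebraicGeometry.Resolution.StrictNormalCrossingsAt
import Literature.AlgebraicGeometry.Resolution.StrictNormalCrossingsDescent
import Literature.AlgebraicGeometry.Resolution.RegularFormallySmoothPrimeField
import Literature.AlgebraicGeometry.Resolution.DualDerivationsPrimeField
import Literature.AlgebraicGeometry.Resolution.PthRootDerivationRegular

/-!
# Route `RadicialJung`, crux `CleanModelsSuffice`, line `Sketch`: the THRESHOLD lemma at a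
# generisation — at most one charged coordinate in `𝔮` ⇒ the normalisation is regular at `η_𝔮`

Helper for the registered stub `stub_gameCentre1` (phase-1 centre of the exceptionalisation game)
of the skeleton of
`Summit.ResolutionOfSingularities.ResolutionOfSingularities.Theses.RadicialJung.CleanModelsSuffice`
(stmt-ResolutionOfSingularities-15883). Ring-level form of step (B ⟹) of the intrinsic count of
charged components (worker notes `work/stubs/GameCentre1_NOTES.md` of the lead's folder): let
`A = 𝒪_{V,v}` be a regular local ring, essentially of finite type over a field `k` of
characteristic `p`, with the clean data of a game state at `v` — a regular system of parameters
`u`, exponents `a` (`0` or prime to `p`), a unit `w`, and a `p`-th root `y ∈ L ∖ K` of the radicand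
`θ = w ∏ uᵢ^{aᵢ}` — and let `O = A_𝔮` be the local ring of a generisation `η_𝔮` (`K = Frac O`,
`[L : K] = p`). If SOME coordinate is charged and AT MOST ONE charged coordinate lies in `𝔮`, then
`integralClosure O L` is a regular local ring:

* one charged `u_{i₁} ∈ 𝔮`: `θ = (unit of O) · u_{i₁}^{a_{i₁}}` with `u_{i₁}` a regular parameter of
  `O` (`IsRsopPart.comp_map_of_le_prime`), and `isRegularLocalRing_integralClosure_of_one_charged`;
* no charged coordinate in `𝔮` (the radicand is a UNIT of `O`; this is the case the derivations
  are for): with `∂ ∈ Der(A)` dual to a charged `u_{i₀}` (`exists_dual_derivations_int`, available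
  because `A` is formally smooth over `𝔽_p`, `formallySmooth_zmod_of_isRegularLocalRing_of_essFiniteType`)
  the order `O[Z]/(Z^p - θ)` is regular local (`isRegularLocalRing_adjoinRoot_localization_of_monomial`,
  Stacks 07PG), hence equals the integral closure, which is regular
  (`CleanResolves.isRegularLocalRing_integralClosure_of_isRegularLocalRing`).
-/

noncomputable section

set_option linter.dupNamespace false -- mandated namespace of this single-conjunct summit

open IsLocalRing Polynomial
open Literature.AlgebraicGeometry.Resolution

namespace Summit.ResolutionOfSingularities.ResolutionOfSingularities.Theorems.RadicialJung.CleanModelsSuffice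

/-- A derivation killing every factor kills a product of powers. [folklore] -/
theorem derivation_prod_pow_eq_zero {A : Type} [CommRing A] (D : Derivation ℤ A A) {ι : Type}
    (s : Finset ι) (f : ι → A) (e : ι → ℕ) (h : ∀ i ∈ s, D (f i) = 0) :
    D (∏ i ∈ s, f i ^ e i) = 0 := by
  classical
  induction s using Finset.induction_on with
  | empty => simp
  | insert j s hj ih =>
    rw [Finset.prod_insert hj, Derivation.leibniz, ih fun i hi => h i (Finset.mem_insert_of_mem hi),
      Derivation.leibniz_pow, h j (Finset.mem_insert_self j s), smul_zero, smul_zero, smul_zero,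
      zero_add, smul_zero]

/-- **Threshold lemma, `⟹` direction: at most one charged coordinate in `𝔮` ⇒ the integral
closure of `O = A_𝔮` in `L` is a regular local ring.** Setting: `A` regular local, essentially of
finite type over a field `k` of characteristic `p`; `u : Fin d → A` a regular system of parameters
(`d = emb dim A`), exponents `aᵢ` (`0` or prime to `p`) with some `aᵢ ≠ 0`, `w ∈ Aˣ`; `O` a
localisation of `A` at the prime `𝔮` with fraction field `K` of characteristic `p`, `[L : K] = p`,
`y ∈ L ∖ K` with `y^p = w ∏ uᵢ^{aᵢ}`; and the charged `uᵢ` lying in `𝔮` are at most one. Then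
`integralClosure O L` is a regular local ring (one charged in `𝔮`:
`isRegularLocalRing_integralClosure_of_one_charged`; none: dual derivation + Stacks 07PG +
`CleanResolves.isRegularLocalRing_integralClosure_of_isRegularLocalRing`). [folklore] -/
theorem isRegularLocalRing_integralClosure_of_charged_le_one
    {A O K L : Type} [CommRing A] [IsRegularLocalRing A] [CommRing O] [Algebra A O]
    (q : Ideal A) [q.IsPrime] [IsLocalization.AtPrime O q] [IsLocalRing O]
    [Field K] [Algebra O K] [IsFractionRing O K] [Algebra A K] [IsScalarTower A O K]
    [Field L] [Algebra K L] [Algebra O L] [IsScalarTower O K L] [Algebra A L] [IsScalarTower A O L]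
    (p : ℕ) (hp : p.Prime) [CharP K p] (hdeg : Module.finrank K L = p)
    (k : Type) [Field k] [CharP k p] [Algebra k A] [Algebra.EssFiniteType k A]
    {d : ℕ} (u : Fin d → A) (hd : (maximalIdeal A).spanFinrank = d)
    (hu : Ideal.span (Set.range u) = maximalIdeal A) (a : Fin d → ℕ)
    (ha : ∀ i, a i = 0 ∨ ¬ p ∣ a i) (w : A) (hw : IsUnit w) (y : L)
    (hy : y ∉ Set.range (algebraMap K L)) (hyp : y ^ p = algebraMap A L (w * ∏ i, u i ^ a i))
    (hch : ∃ i, a i ≠ 0)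
    (hq1 : ∀ i j, a i ≠ 0 → a j ≠ 0 → u i ∈ q → u j ∈ q → i = j) :
    IsRegularLocalRing (integralClosure O L) := by
  classical
  haveI : Fact p.Prime := ⟨hp⟩
  haveI : IsDomain A := isDomain_of_isRegularLocalRing A
  -- transports of characteristic and regularity
  have hinjAO : Function.Injective (algebraMap A O) :=
    IsLocalization.injective O q.primeCompl_le_nonZeroDivisors
  haveI : CharP O p := RingHom.charP _ (IsFractionRing.injective O K) p
  haveI : CharP A p := RingHom.charP _ hinjAO p
  haveI : CharP L p := charP_of_injective_algebraMap (algebraMap K L).injective p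
  haveI := isRegularLocalRing_localization_atPrime A q
  haveI : IsRegularLocalRing O := IsRegularLocalRing.of_ringEquiv
    (IsLocalization.algEquiv q.primeCompl (Localization.AtPrime q) O).toRingEquiv
  haveI : FiniteDimensional K L := Module.finite_of_finrank_pos (by rw [hdeg]; exact hp.pos)
  have hrsop : IsRsopPart u := by
    have h := isRsopPart_comp_of_rsop hd u hu id Function.injective_id
    rwa [Function.comp_id] at h
  have hypO : y ^ p = algebraMap O L (algebraMap A O (w * ∏ i, u i ^ a i)) := by
    rw [← IsScalarTower.algebraMap_apply]
    exact hyp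
  -- charged coordinates outside `𝔮` become units of `O`
  have hunit : ∀ i, u i ∉ q ∨ a i = 0 → IsUnit (algebraMap A O (u i ^ a i)) := by
    rintro i (hi | hi)
    · rw [map_pow]
      exact (IsLocalization.map_units O (⟨u i, hi⟩ : q.primeCompl)).pow _
    · rw [hi, pow_zero, map_one]
      exact isUnit_one
  by_cases hcase : ∃ i₁, a i₁ ≠ 0 ∧ u i₁ ∈ q
  · /- ONE charged coordinate `u_{i₁} ∈ 𝔮`: `θ = (unit) · u_{i₁}^{a_{i₁}}` in `O`. -/
    obtain ⟨i₁, ha₁, hu₁⟩ := hcase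
    have h1 : IsRsopPart (fun _ : Fin 1 => algebraMap A O (u i₁)) :=
      hrsop.comp_map_of_le_prime (fun _ : Fin 1 => i₁) (fun _ _ _ => Subsingleton.elim _ _) q
        (fun _ => hu₁) O
    have ht : algebraMap A O (u i₁) ∈ maximalIdeal O := h1.mem_maximalIdeal 0
    have ht2 : algebraMap A O (u i₁) ∉ maximalIdeal O ^ 2 := h1.not_mem_sq 0
    have he : IsUnit (algebraMap A O (w * ∏ i ∈ Finset.univ.erase i₁, u i ^ a i)) := by
      rw [map_mul, map_prod]
      refine (hw.map _).mul ?_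
      refine Finset.prod_induction _ IsUnit (fun x y hx hy => hx.mul hy) isUnit_one
        fun i hi => hunit i ?_
      rw [Finset.mem_erase] at hi
      by_cases hai : a i = 0
      · exact Or.inr hai
      · exact Or.inl fun hiq => hi.1 (hq1 i i₁ hai ha₁ hiq hu₁)
    have hθ : w * ∏ i, u i ^ a i = (w * ∏ i ∈ Finset.univ.erase i₁, u i ^ a i) * u i₁ ^ a i₁ := by
      rw [mul_assoc, Finset.prod_erase_mul _ _ (Finset.mem_univ i₁)]
    refine isRegularLocalRing_integralClosure_of_one_charged (K := K) p hp hdeg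
      (algebraMap A O (u i₁)) _ ht ht2 he (a i₁) ((ha i₁).resolve_left ha₁) y hy ?_
    rw [hypO, hθ, map_mul, map_pow]
  · /- NO charged coordinate in `𝔮`: the radicand is a unit of `O`; use a dual derivation. -/
    push Not at hcase
    obtain ⟨i₀, ha₀⟩ := hch
    have ha₀' : ¬ p ∣ a i₀ := (ha i₀).resolve_left ha₀
    -- `A` is formally smooth over `𝔽_p`, so `u` has dual derivations
    letI : Algebra (ZMod p) A := ZMod.algebra A p
    haveI : Algebra.FormallySmooth (ZMod p) A :=
      formallySmooth_zmod_of_isRegularLocalRing_of_essFiniteType p k A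
    have hli : LinearIndependent (ResidueField A)
        fun i => (maximalIdeal A).toCotangent ⟨u i, hrsop.mem_maximalIdeal i⟩ := by
      rw [linearIndependent_toCotangent_iff_forall_mem]
      exact fun c hc i => mem_maximalIdeal_of_sum_mul_rsop_mem_sq hd u hu c hc i
    obtain ⟨δ, hδ⟩ := exists_dual_derivations_int p u (fun i => hrsop.mem_maximalIdeal i) hli
    -- `θ = w · u_{i₀}^{a_{i₀}} · m`, `∂m = 0`, `m ∉ 𝔮`
    set m : A := ∏ i ∈ Finset.univ.erase i₀, u i ^ a i with hm_def
    have hm0 : δ i₀ m = 0 := by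
      refine derivation_prod_pow_eq_zero (δ i₀) _ u a fun i hi => ?_
      rw [hδ, if_neg]
      exact fun h => (Finset.mem_erase.mp hi).1 h.symm
    have hmq : m ∉ q := by
      rw [hm_def]
      refine Finset.prod_induction _ (· ∉ q) (fun x y hx hy hxy => ?_)
        (fun h1 => (Ideal.IsPrime.ne_top ‹_›) (Ideal.eq_top_of_isUnit_mem _ h1 isUnit_one))
        fun i _ => ?_
      · exact (Ideal.IsPrime.mem_or_mem ‹_› hxy).elim hx hy
      · by_cases hai : a i = 0
        · rw [hai, pow_zero]
          exact fun h1 => (Ideal.IsPrime.ne_top ‹_›) (Ideal.eq_top_of_isUnit_mem _ h1 isUnit_one)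
        · exact fun h => hcase i hai (Ideal.IsPrime.mem_of_pow_mem ‹_› _ h)
    have hθ : w * ∏ i, u i ^ a i = w * u i₀ ^ a i₀ * m := by
      conv_lhs => rw [← Finset.mul_prod_erase Finset.univ (fun i => u i ^ a i) (Finset.mem_univ i₀)]
      simp only [hm_def, mul_assoc]
    haveI hreg : IsRegularLocalRing
        (AdjoinRoot ((X : O[X]) ^ p - C (algebraMap A O (w * u i₀ ^ a i₀ * m)))) :=
      isRegularLocalRing_adjoinRoot_localization_of_monomial p (δ i₀) w (u i₀) m hw
        (hrsop.mem_maximalIdeal i₀) (a i₀) ha₀' (by rw [hδ, if_pos rfl]) hm0 q (hcase i₀ ha₀) hmq O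
    rw [← hθ] at hreg
    exact CleanResolves.isRegularLocalRing_integralClosure_of_isRegularLocalRing (K := K) hp hdeg
      (algebraMap A O (w * ∏ i, u i ^ a i)) y hy hypO

end Summit.ResolutionOfSingularities.ResolutionOfSingularities.Theorems.RadicialJung.CleanModelsSuffice

end
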